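import Mathlib
import Summits.KontsevichZagierPeriods.Zeta5Search.TS1RayMinors
import Summits.KontsevichZagierPeriods.Zeta5Search.TS1RayDominanceLow
import HarnessLib

/-!
# ζ(5) search — (QV) and (P̂V) on the WHOLE TOP_STAIR #1 ray (H1), every direction `j`, all `n`: the counting range `2p ≤ 17n` and the assembly

Cell `pub-zeta5` (HONEST FRAMING: systematic search; no irrationality claim unless certified), TRACK «DENOM-LAW» D1 prover seat
(denom-prover-d1 g13, `HOME/denom-law/prover-d1/ATTEMPT-13.md` §4).  Completes `TS1RayMinors` (`2p > 17n`) below the first period by COUNTING, exactly as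
g12's `FlagRayMinorsAll`: on `152n < 35p`, `2p ≤ 17n` the interval certificate of `TS1RayDominanceLow` (`ts1_mid_bounds`: margin
`L + min(0,3+L) − (refund − N_p) ≥ 0` and `N_p ≥ 1`, `L` the counting lower bound of every class exponent) dominates both minor laws
(`min(0,5+L) + min(0,3+L) ≥ L + min(0,3+L)` for `L ≤ 0`), and on `35p ≤ 152n + 23` the tree's linear counts `mul_countBound_ge` / `mul_pairFloors_ge`
give `2L + N_p ≥ −5`, `L + N_p ≥ 1`, `N_p ≥ 1`.  Results: **`ts1RayQV`, `ts1RayPhatV` — (QV) `v_p(U(b)W(b+e_j) − U(b+e_j)W(b)) ≥ refund − N_p` and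
(P̂V) `v_p(U(b)V(b+e_j) − U(b+e_j)V(b)) ≥ refund − 1 − N_p` for `b = b(n) = n·(34;14,…,8)`, EVERY `n ≥ 1`, every `1 ≤ j ≤ 7`, every prime `p ≥ 5` with
`p² > 34n + 2`** — and the nodes `QMinorValuationLaw` / `PhatMinorValuationLaw` restricted to the ray with binders verbatim (`qMinorValuationLaw_on_h1`,
plus the window; `phatMinorValuationLaw_on_h1`).  With g11's record ray and g12's flag ray, all four gen-2 g5 laws ((WV) tree-wide, (CV), (QV), (P̂V))
are theorems for every `n` on all three long-row census rays.  MODEL/structure-side valuation bookkeeping; the ∀-b nodes stay OPEN; nothing about ζ(5);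
no γ; records in print UNMOVED.
-/

open Finset

namespace Summit.KontsevichZagierPeriods.Zeta5Search.StairTS1

open Summit.KontsevichZagierPeriods.Zeta5Search.ClusterValuation
open Summit.KontsevichZagierPeriods.Zeta5Search.CasoratianValuation (InPolytope shift casoratian pairFloors refund minorQ minorPhat)
open Summit.KontsevichZagierPeriods.Zeta5Search.WedgeDictionary (dOf coeffU coeffW coeffV)
open Summit.KontsevichZagierPeriods.Zeta5Search.CellKit (bLin)
open Summit.KontsevichZagierPeriods.Zeta5Search.CellA (classExp_le_classNu)
open Summit.KontsevichZagierPeriods.Zeta5Search.ClusterValuation.MinorBounds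

/-! ## §2 The low range `2p ≤ 17n` by counting -/

/-- **(QV) and (P̂V) on `152n < 35p`, `2p ≤ 17n`** from the interval certificate of `TS1RayDominanceLow` (`ts1_mid_bounds`). -/
theorem minors_mid (n j p : ℕ) (hn : 1 ≤ n) (hj1 : 1 ≤ j) (hj7 : j ≤ 7) (hprime : p.Prime) (hp5 : 5 ≤ p)
    (hwin : ((bLin (8 * n) (6 * n) n) 0 + 2 : ℤ) < (p : ℤ) ^ 2) (hlo : 152 * n < 35 * p) (hhi : 2 * p ≤ 17 * n) :
    (minorQ (bLin (8 * n) (6 * n) n) j ≠ 0 →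
      refund (bLin (8 * n) (6 * n) n) p - pairFloors (bLin (8 * n) (6 * n) n) p ≤ padicValRat p (minorQ (bLin (8 * n) (6 * n) n) j)) ∧
    (minorPhat (bLin (8 * n) (6 * n) n) j ≠ 0 →
      refund (bLin (8 * n) (6 * n) n) p - 1 - pairFloors (bLin (8 * n) (6 * n) n) p ≤ padicValRat p (minorPhat (bLin (8 * n) (6 * n) n) j)) := by
  haveI : Fact p.Prime := ⟨hprime⟩
  have hp : 0 < p := hprime.pos
  have hb := inPolytope_h1 n
  obtain ⟨hmargin, hN1⟩ := ts1_mid_bounds n p hp hlo hhi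
  set L : ℤ := (bLin (8 * n) (6 * n) n 0) / (p : ℤ)
      - ∑ j ∈ range 7, ((bLin (8 * n) (6 * n) n 0 - 2 * bLin (8 * n) (6 * n) n (j + 1)) / (p : ℤ) + 1) with hLdef
  set N : ℤ := pairFloors (bLin (8 * n) (6 * n) n) p with hNdef
  have hEL : ∀ x, x < p → L ≤ classExp (bLin (8 * n) (6 * n) n) p x := fun x hx => classExp_ge_count _ hb hp hx
  have hmb := minors_of_bounds (bLin (8 * n) (6 * n) n) hb hj1 (inPolytope_shift_h1_j hn j hj1 hj7) hp5 hwin (min 0 (5 + L)) (min 0 (3 + L)) L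
    (min_le_left _ _) (min_le_left _ _) (fun x hx _ => by have := hEL x hx; have := min_le_right (0:ℤ) (5 + L); omega)
    (fun x hx _ => by have := hEL x hx; have := min_le_right (0:ℤ) (3 + L); omega)
    (fun x hx _ => (hEL x hx).trans (classExp_le_classNu _ p x))
  have hr : refund (bLin (8 * n) (6 * n) n) p ≤ 1 := min_le_left _ _
  refine ⟨fun hne => le_trans ?_ (hmb.1 hne), fun hne => le_trans ?_ (hmb.2 hne)⟩
  · rcases le_or_gt L 0 with hL0 | hL0
    · have h1 : min (0:ℤ) (5 + L) + min 0 (3 + L) ≥ L + min 0 (3 + L) := by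
        rcases le_or_gt (5 + L) 0 with h5 | h5
        · rw [min_eq_right h5]; linarith [min_le_right (0:ℤ) (3+L)]
        · rw [min_eq_left h5.le]; linarith
      linarith
    · rw [min_eq_left (by linarith : (0:ℤ) ≤ 5 + L), min_eq_left (by linarith : (0:ℤ) ≤ 3 + L)]
      linarith
  · have h1 : min (0:ℤ) (5 + L) + L ≥ L + min 0 (3 + L) := by
      rcases le_or_gt (5 + L) 0 with h5 | h5
      · rw [min_eq_right h5, min_eq_right (by linarith : (3:ℤ) + L ≤ 0)]; linarith
      · rw [min_eq_left h5.le]; linarith [min_le_left (0:ℤ) (3 + L)]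
    linarith

/-- **(QV) and (P̂V) on `35p ≤ 152n + 23`** by the tree's linear counts (`p·L ≥ −2d − 8p + 1`, `p·N_p ≥ 3(b₀+2d) − 21(p−1)`), which give
`2L + N_p ≥ −5`, `L + N_p ≥ 1`, `N_p ≥ 1`. -/
theorem minors_small (n j p : ℕ) (hn : 1 ≤ n) (hj1 : 1 ≤ j) (hj7 : j ≤ 7) (hprime : p.Prime) (hp5 : 5 ≤ p)
    (hwin : ((bLin (8 * n) (6 * n) n) 0 + 2 : ℤ) < (p : ℤ) ^ 2) (hsmall : 35 * p ≤ 152 * n + 23) :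
    (minorQ (bLin (8 * n) (6 * n) n) j ≠ 0 →
      refund (bLin (8 * n) (6 * n) n) p - pairFloors (bLin (8 * n) (6 * n) n) p ≤ padicValRat p (minorQ (bLin (8 * n) (6 * n) n) j)) ∧
    (minorPhat (bLin (8 * n) (6 * n) n) j ≠ 0 →
      refund (bLin (8 * n) (6 * n) n) p - 1 - pairFloors (bLin (8 * n) (6 * n) n) p ≤ padicValRat p (minorPhat (bLin (8 * n) (6 * n) n) j)) := by
  haveI : Fact p.Prime := ⟨hprime⟩
  have hp : 0 < p := hprime.pos
  have hpZ : (0 : ℤ) < p := by exact_mod_cast hp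
  have hn1 : (1 : ℤ) ≤ n := by exact_mod_cast hn
  have hb := inPolytope_h1 n
  set L : ℤ := (bLin (8 * n) (6 * n) n) 0 / (p : ℤ) - ∑ j ∈ range 7, (((bLin (8 * n) (6 * n) n) 0 - 2 * (bLin (8 * n) (6 * n) n) (j + 1)) / (p : ℤ) + 1) with hLdef
  set N : ℤ := pairFloors (bLin (8 * n) (6 * n) n) p with hNdef
  have hcL := mul_countBound_ge (bLin (8 * n) (6 * n) n) hp
  have hcN := mul_pairFloors_ge (bLin (8 * n) (6 * n) n) hp
  rw [← hLdef, dOf_h1] at hcL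
  rw [← hNdef, dOf_h1, w0] at hcN
  have hsm : (35 * p : ℤ) ≤ 152 * n + 23 := by exact_mod_cast hsmall
  -- `2L + N ≥ −5`, `L + N ≥ 1`, `N ≥ 1`
  have h1 : -5 ≤ 2 * L + N := by
    by_contra hc; push Not at hc
    have h : (p : ℤ) * (2 * L + N) ≤ (p : ℤ) * (-6) := mul_le_mul_of_nonneg_left (by omega) hpZ.le
    have e : (p : ℤ) * (2 * L + N) = 2 * ((p : ℤ) * L) + (p : ℤ) * N := by ring
    rw [e] at h
    linarith
  have h2 : 1 ≤ L + N := by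
    by_contra hc; push Not at hc
    have h : (p : ℤ) * (L + N) ≤ (p : ℤ) * 0 := mul_le_mul_of_nonneg_left (by omega) hpZ.le
    have e : (p : ℤ) * (L + N) = (p : ℤ) * L + (p : ℤ) * N := by ring
    rw [e] at h
    linarith
  have h3 : 1 ≤ N := by
    by_contra hc; push Not at hc
    have h : (p : ℤ) * N ≤ (p : ℤ) * 0 := mul_le_mul_of_nonneg_left (by omega) hpZ.le
    linarith
  have hEL : ∀ x, x < p → L ≤ classExp (bLin (8 * n) (6 * n) n) p x := fun x hx => classExp_ge_count _ hb hp hx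
  have hmb := minors_of_bounds (bLin (8 * n) (6 * n) n) hb hj1 (inPolytope_shift_h1_j hn j hj1 hj7) hp5 hwin (min 0 (5 + L)) (min 0 (3 + L)) L
    (min_le_left _ _) (min_le_left _ _) (fun x hx _ => by have := hEL x hx; have := min_le_right (0:ℤ) (5 + L); omega)
    (fun x hx _ => by have := hEL x hx; have := min_le_right (0:ℤ) (3 + L); omega)
    (fun x hx _ => (hEL x hx).trans (classExp_le_classNu _ p x))
  have hr : refund (bLin (8 * n) (6 * n) n) p ≤ 1 := min_le_left _ _
  refine ⟨fun hne => le_trans ?_ (hmb.1 hne), fun hne => le_trans ?_ (hmb.2 hne)⟩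
  · rcases le_or_gt (5 + L) 0 with h5 | h5
    · rw [min_eq_right h5, min_eq_right (by linarith : (3:ℤ) + L ≤ 0)]; linarith
    · rw [min_eq_left h5.le]
      rcases le_or_gt (3 + L) 0 with h3' | h3'
      · rw [min_eq_right h3']; linarith
      · rw [min_eq_left h3'.le]; linarith
  · rcases le_or_gt (5 + L) 0 with h5 | h5
    · rw [min_eq_right h5]; linarith
    · rw [min_eq_left h5.le]; linarith

/-! ## §3 (QV) and (P̂V) on the whole ray H1 -/

/-- **(QV) ON THE WHOLE RAY H1 = TOP_STAIR #1, every direction `j`, all `n`**: for `n ≥ 1`, `1 ≤ j ≤ 7`, every prime `p ≥ 5` with `p² > 34n + 2` and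
`minorQ_j(b(n)) ≠ 0`: `refund − N_p ≤ v_p(U(b)W(b+e_j) − U(b+e_j)W(b))`. -/
theorem ts1RayQV (n j p : ℕ) (hn : 1 ≤ n) (hj1 : 1 ≤ j) (hj7 : j ≤ 7) (hprime : p.Prime) (hp5 : 5 ≤ p)
    (hwin : (34 * n + 2 : ℤ) < (p : ℤ) ^ 2) (hne : minorQ (bLin (8 * n) (6 * n) n) j ≠ 0) :
    refund (bLin (8 * n) (6 * n) n) p - pairFloors (bLin (8 * n) (6 * n) n) p ≤ padicValRat p (minorQ (bLin (8 * n) (6 * n) n) j) := by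
  haveI : Fact p.Prime := ⟨hprime⟩
  have hwin' : ((bLin (8 * n) (6 * n) n) 0 + 2 : ℤ) < (p : ℤ) ^ 2 := by rw [w0]; linarith
  by_cases h85 : 17 * n < 2 * p
  · exact (minors_gt85 (p := p) hn hj1 hj7 hprime h85).1 hne
  push Not at h85
  by_cases hlo : 152 * n < 35 * p
  · exact (minors_mid n j p hn hj1 hj7 hprime hp5 hwin' hlo h85).1 hne
  · exact (minors_small n j p hn hj1 hj7 hprime hp5 hwin' (by omega)).1 hne

/-- **(P̂V) ON THE WHOLE RAY H1 = TOP_STAIR #1, every direction `j`, all `n`**: `refund − 1 − N_p ≤ v_p(U(b)V(b+e_j) − U(b+e_j)V(b))`. -/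
theorem ts1RayPhatV (n j p : ℕ) (hn : 1 ≤ n) (hj1 : 1 ≤ j) (hj7 : j ≤ 7) (hprime : p.Prime) (hp5 : 5 ≤ p)
    (hwin : (34 * n + 2 : ℤ) < (p : ℤ) ^ 2) (hne : minorPhat (bLin (8 * n) (6 * n) n) j ≠ 0) :
    refund (bLin (8 * n) (6 * n) n) p - 1 - pairFloors (bLin (8 * n) (6 * n) n) p ≤ padicValRat p (minorPhat (bLin (8 * n) (6 * n) n) j) := by
  haveI : Fact p.Prime := ⟨hprime⟩
  have hwin' : ((bLin (8 * n) (6 * n) n) 0 + 2 : ℤ) < (p : ℤ) ^ 2 := by rw [w0]; linarith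
  by_cases h85 : 17 * n < 2 * p
  · exact (minors_gt85 (p := p) hn hj1 hj7 hprime h85).2 hne
  push Not at h85
  by_cases hlo : 152 * n < 35 * p
  · exact (minors_mid n j p hn hj1 hj7 hprime hp5 hwin' hlo h85).2 hne
  · exact (minors_small n j p hn hj1 hj7 hprime hp5 hwin' (by omega)).2 hne

/-- **The node `QMinorValuationLaw` restricted to TOP_STAIR #1**, binders verbatim with `b := b(n)`, plus the window `p² > b₀ + 2`
(the node itself asks every prime `p ≥ 5`; below the window this file's tools do not reach). -/
theorem qMinorValuationLaw_on_h1 (n j p : ℕ) (hn : 1 ≤ n) (hwin : ((bLin (8 * n) (6 * n) n) 0 + 2 : ℤ) < (p : ℤ) ^ 2) :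
    InPolytope (bLin (8 * n) (6 * n) n) → 1 ≤ j → j ≤ 7 → InPolytope (shift (bLin (8 * n) (6 * n) n) j) →
    p.Prime → 5 ≤ p → minorQ (bLin (8 * n) (6 * n) n) j ≠ 0 →
      refund (bLin (8 * n) (6 * n) n) p - pairFloors (bLin (8 * n) (6 * n) n) p ≤ padicValRat p (minorQ (bLin (8 * n) (6 * n) n) j) := by
  intro _ hj1 hj7 _ hprime hp5 hne
  rw [w0] at hwin
  exact ts1RayQV n j p hn hj1 hj7 hprime hp5 (by linarith) hne

/-- **The node `PhatMinorValuationLaw` restricted to TOP_STAIR #1**, binders verbatim with `b := b(n)`. -/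
theorem phatMinorValuationLaw_on_h1 (n j p : ℕ) (hn : 1 ≤ n) :
    InPolytope (bLin (8 * n) (6 * n) n) → 1 ≤ j → j ≤ 7 → InPolytope (shift (bLin (8 * n) (6 * n) n) j) →
    p.Prime → 5 ≤ p → ((bLin (8 * n) (6 * n) n) 0 + 2 : ℤ) < (p : ℤ) ^ 2 → minorPhat (bLin (8 * n) (6 * n) n) j ≠ 0 →
      refund (bLin (8 * n) (6 * n) n) p - 1 - pairFloors (bLin (8 * n) (6 * n) n) p ≤ padicValRat p (minorPhat (bLin (8 * n) (6 * n) n) j) := by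
  intro _ hj1 hj7 _ hprime hp5 hwin hne
  rw [w0] at hwin
  exact ts1RayPhatV n j p hn hj1 hj7 hprime hp5 (by linarith) hne

end Summit.KontsevichZagierPeriods.Zeta5Search.StairTS1
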